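import Summits.ResolutionOfSingularities.ResolutionOfSingularities.Theorems.PurelyInseparableDim4ResConeCInfGameReadings
import Summits.ResolutionOfSingularities.ResolutionOfSingularities.Theorems.PurelyInseparableDim4ResConeCInfGameWindow
import HarnessLib
import HarnessLib.Audit.Tags

/-!
# Purely inseparable four-folds — the C∞ WINDOW IS PLAYED: nine pure corner steps of a framed chain after a letter
# change `λμ` feed res-dim4-p-9 g3's window game, which has no such play (cell `res-dim4-pi`, K2(p) lane, slice B;
# C∞ assembly K24c L2b, the game half)

[OURS · counted 0 · cell `res-dim4-pi` · K2(p) lane holder res-dim4-p-12 g3 (design (iii) «LOCAL WINDOW re-framed at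
the letter change», bus 2026-08-29 02:51Z); C∞ assembly owner res-dim4-p-3 g4.]  Nothing here proves K2(p)/K2(5),
`NoIsolatedTrap 5 5` or resolution of singularities in dimension ≥ 4 / characteristic `p` — NOT proved.  AI kernel
work, weaker than expert review.

THE GAME HALF OF THE ASSEMBLY.  Fixed letters `λ, μ, u, f`; a sequence of states `c 0, …, c 9` and charts
`j 0, …, j 8` such that, on the window, every step is a PURE CORNER step in a slot chart
(`c (t+1) = CentreBlowup.step 5 univ (j t) 0 (c t)`, `j t ∈ {λ, μ}`), every state is ISOLATED of order `6` with
`e_G = 3`, ledger `r = x_λ x_μ` dividing `F`, STRAIGHT residual cone `resForm = a·x_f⁴`, and the EXACT pair-ledger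
support form holds at the window start — exactly what res-dim4-p-2 g4's `cInf_frame_window` (F2c) delivers on
a re-framed tail, with the exact ledger of `…ResConeExactPairLedger` — and the window opens with the letter change
`j 0 = λ`, `j 1 = μ`.  Then **`cInf_window_false`**: contradiction.  Route: the play
`P t (c,a,b,e) :⟺ c ≤ 3 ∧ coeff ((a+2)λ + (b+2)μ + e·u + (3−c)f) F_t ≠ 0` along the word `x t := (j t = λ)` satisfies
the eleven hypotheses of res-dim4-p-9 g3's `CInfGame.Window.no_play_after_change` (αW, p692304): `hfwdL/hfwdM` by
res-dim4-p-2 g4's F2a `coeff_step_zero_gameExp_ne_zero`, `hlegL/hlegM`, `hflagL/hflagM`, `hevol` by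
`…ResConeCInfGameReadings` (F3 of res-dim4-p-3 g3 inside), the exact ledger being pushed along the window by F2a's
`ledger_step_zero` at every order (§1 `cInf_window_ledger`).
* §1 straightness and ledger bookkeeping on the window (`straight_readings_of_resForm`, `straight_support_of_resForm`,
  `cInf_window_ledger`, `tsch_row_of_ledger`).
* §2 **`cInf_window_false`**.

[cite: CossartJannsenSaito2020, Thm. 3.14, Lemma 13.2]
bears_on: LADDER-RESOLUTION:D157-DOOR2 (res-dim4-pi · K2(p) slice B · C∞ window played).
Supports stmt-ResolutionOfSingularities-16155 (helper).
-/

set_option linter.dupNamespace false -- mandated namespace of this single-conjunct summit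

noncomputable section

namespace Summit.ResolutionOfSingularities.ResolutionOfSingularities.Theorems.PIDim4

namespace ResCone

open MvPolynomial Finset
open Literature.AlgebraicGeometry.Resolution
open Literature.AlgebraicGeometry.Resolution.CentreBlowup
open Literature.AlgebraicGeometry.Resolution.Hauser2010
open Literature.AlgebraicGeometry.Resolution.HauserPerlega2019

variable {K : Type} [Field K]

/-! ## §1 Straightness and the ledger along the window -/

/-- **Straight readings from a straight residual cone**: if `resForm s = a·x_f⁴`, `ord₀ F = 6`, `|r| = 2`, `x^r ∣ F`, then
`coeff_{r+4e_f} F = a` and every other residual degree-`4` reading vanishes. [OURS · bookkeeping] -/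
theorem straight_readings_of_resForm {f : Fin 4} {s : State K} (ho : ordZero s.F = (6 : ℕ))
    (hrdeg : s.r.degree = 2) {a : K} (hform : resForm s = C a * X f ^ 4) :
    coeff (s.r + Finsupp.single f 4) s.F = a ∧
      ∀ m : Fin 4 →₀ ℕ, m.degree = 4 → m ≠ Finsupp.single f 4 → coeff (s.r + m) s.F = 0 := by
  classical
  have hread : ∀ m : Fin 4 →₀ ℕ, m.degree = 4 → coeff (s.r + m) s.F = coeff m (C a * X f ^ 4) := by
    intro m hm
    rw [← hform, coeff_resForm, NarrowApolarity.coeff_initialForm_of_degree_eq ho (by rw [map_add, hrdeg, hm])]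
  refine ⟨?_, fun m hm hne => ?_⟩
  · rw [hread _ (Finsupp.degree_single _ _), X_pow_eq_monomial, C_mul_monomial, mul_one, coeff_monomial, if_pos rfl]
  · rw [hread m hm, X_pow_eq_monomial, C_mul_monomial, mul_one, coeff_monomial, if_neg (Ne.symm hne)]

/-- **Straight support**: then every degree-`6` monomial of `F` has `x_f`-exponent `4` (`a ≠ 0` not even needed for
this direction when combined with `straight_support_of_straight`). [OURS · bookkeeping] -/
theorem straight_support_of_resForm {f : Fin 4} {s : State K} (ho : ordZero s.F = (6 : ℕ))
    (hdiv : ∀ e ∈ s.F.support, s.r ≤ e) (hrdeg : s.r.degree = 2) (hrf : s.r f = 0) {a : K}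
    (hform : resForm s = C a * X f ^ 4) : ∀ d ∈ s.F.support, d.degree = 6 → d f = 4 :=
  straight_support_of_straight hdiv hrdeg hrf (straight_readings_of_resForm ho hrdeg hform).2

/-- Every monomial of `x_f`-degree `≤ 3` of a straight state of order `6` has degree `≥ 7`. [OURS · bookkeeping] -/
theorem seven_le_degree_of_resForm {f : Fin 4} {s : State K} (ho : ordZero s.F = (6 : ℕ))
    (hdiv : ∀ e ∈ s.F.support, s.r ≤ e) (hrdeg : s.r.degree = 2) (hrf : s.r f = 0) {a : K}
    (hform : resForm s = C a * X f ^ 4) : ∀ d ∈ s.F.support, d f ≤ 3 → 7 ≤ d.degree := by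
  intro d hd hdf
  have h6 := le_degree_of_ordZero_eq ho d hd
  by_contra hlt
  have h4 := straight_support_of_resForm ho hdiv hrdeg hrf hform d hd (by omega)
  omega

/-- **The Tschirnhaus / ledger row from the exact ledger**: if every monomial of `x_f`-degree `≤ 3` has
`x_o`-exponent `≥ 2`, the reading `coeff_{r + 3e_f + 2e_κ} F` (`r = e_κ + e_o`) vanishes — F3's `htsch`.
[OURS · bookkeeping] -/
theorem tsch_row_of_ledger {κ o f : Fin 4} (hκo : κ ≠ o) (hκf : κ ≠ f) (hof : o ≠ f) {s : State K}
    (hr : s.r = Finsupp.single κ 1 + Finsupp.single o 1)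
    (hled : ∀ d ∈ s.F.support, d f ≤ 3 → 2 ≤ d o) :
    coeff (s.r + (Finsupp.single f 3 + Finsupp.single κ 2)) s.F = 0 := by
  by_contra h
  have hmem := mem_support_iff.mpr h
  have hf : (s.r + (Finsupp.single f 3 + Finsupp.single κ 2) : Fin 4 →₀ ℕ) f = 3 := by
    rw [hr]; simp [Finsupp.add_apply, hκf, hof]
  have ho' : (s.r + (Finsupp.single f 3 + Finsupp.single κ 2) : Fin 4 →₀ ℕ) o = 1 := by
    rw [hr]; simp [Finsupp.add_apply, hκo, hof.symm]
  have := hled _ hmem (by rw [hf])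
  rw [ho'] at this
  omega

section Window

variable [CharP K 5] [DecidableEq K]
variable {la mu u f : Fin 4} (hlm : la ≠ mu) (hlu : la ≠ u) (hlf : la ≠ f) (hmu : mu ≠ u) (hmf : mu ≠ f)
  (huf : u ≠ f)
include hlm hlu hlf hmu hmf huf

omit [CharP K 5] in
/-- **THE EXACT PAIR LEDGER RIDES THE WINDOW**: along pure corner steps in slot charts of straight states of order `6`
with ledger `x_λ x_μ ∣ F`, the support form «`x_f`-degree `≤ 3` ⇒ `x_λ², x_μ² ∣`» propagates from the start to every
state of the window (F2a `ledger_step_zero` at every order). [OURS] [cite: CossartJannsenSaito2020, Lemma 13.2] -/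
theorem cInf_window_ledger {c : ℕ → State K} {j : ℕ → Fin 4} {T : ℕ}
    (ho : ∀ t, t ≤ T → ordZero (c t).F = (6 : ℕ))
    (hdiv : ∀ t, t ≤ T → ∀ e ∈ (c t).F.support, (c t).r ≤ e)
    (hstep : ∀ t, t < T → c (t + 1) = CentreBlowup.step 5 Finset.univ (j t) 0 (c t))
    (hslot : ∀ t, t < T → j t = la ∨ j t = mu)
    (hr : ∀ t, t ≤ T → (c t).r = Finsupp.single la 1 + Finsupp.single mu 1)
    (hform : ∀ t, t ≤ T → ∃ a : K, resForm (c t) = C a * X f ^ 4)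
    (hled0 : ∀ e ∈ (c 0).F.support, e f ≤ 3 → 2 ≤ e la ∧ 2 ≤ e mu) :
    ∀ t, t ≤ T → ∀ e ∈ (c t).F.support, e f ≤ 3 → 2 ≤ e la ∧ 2 ≤ e mu := by
  intro t
  induction t with
  | zero => exact fun _ => hled0
  | succ t ih =>
    intro ht e he hef
    have ht' : t ≤ T := Nat.le_of_succ_le ht
    have hlt : t < T := Nat.lt_of_succ_le ht
    have ih' := ih ht'
    have hrdeg : (c t).r.degree = 2 := by rw [hr t ht', map_add, Finsupp.degree_single, Finsupp.degree_single]
    have hrf : (c t).r f = 0 := by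
      rw [hr t ht', Finsupp.add_apply, Finsupp.single_eq_of_ne hlf.symm, Finsupp.single_eq_of_ne hmf.symm, add_zero]
    obtain ⟨a, hfa⟩ := hform t ht'
    have h7 := seven_le_degree_of_resForm (ho t ht') (hdiv t ht') hrdeg hrf hfa
    have hla1 : ∀ d ∈ (c t).F.support, 1 ≤ d la := fun d hd => by
      have h := hdiv t ht' d hd la
      rw [hr t ht', Finsupp.add_apply, Finsupp.single_eq_same, Finsupp.single_eq_of_ne hlm] at h
      omega
    have hmu1 : ∀ d ∈ (c t).F.support, 1 ≤ d mu := fun d hd => by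
      have h := hdiv t ht' d hd mu
      rw [hr t ht', Finsupp.add_apply, Finsupp.single_eq_of_ne (Ne.symm hlm), Finsupp.single_eq_same] at h
      omega
    rw [hstep t hlt] at he
    rcases hslot t hlt with hj | hj
    · rw [hj] at he
      exact ledger_step_zero hlm hlu hlf hmu hmf huf (c t) hmu1 h7 (N := e.degree + 5)
        (fun d hd hdf _ => ih' d hd hdf) e he hef (by omega)
    · rw [hj] at he
      have h := ledger_step_zero (Ne.symm hlm) hmu hmf hlu hlf huf (c t) hla1 h7 (N := e.degree + 5)
        (fun d hd hdf _ => (ih' d hd hdf).symm) e he hef (by omega)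
      exact h.symm

/-! ## §2 The window is played: contradiction -/

/-- **THE C∞ WINDOW CANNOT BE PLAYED** (K24c L2b, game half).  Fixed letters `λ, μ, u, f`; states `c 0 … c 9`
and charts `j 0 … j 8` with: pure corner steps `c (t+1) = step 5 univ (j t) 0 (c t)` in slot charts `j t ∈ {λ, μ}`
(`t ≤ 8`), every state isolated of order `6` with `e_G = 3`, ledger `r_t = x_λ x_μ ∣ F_t` and straight residual cone
`resForm (c t) = a_t·x_f⁴` (`t ≤ 9`), the exact pair-ledger support form at `c 0`, and the LETTER CHANGE `j 0 = λ`,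
`j 1 = μ`.  Then `False`: the supports `P t (c,a,b,e) :⟺ c ≤ 3 ∧ coeff ((a+2)λ+(b+2)μ+e·u+(3−c)f) F_t ≠ 0` along
`x t := (j t = λ)` are a legal doubly-flagged play of res-dim4-p-9 g3's window game, which
`CInfGame.Window.no_play_after_change` forbids. [OURS] [cite: CossartJannsenSaito2020, Thm. 3.14] -/
theorem cInf_window_false {c : ℕ → State K} {j : ℕ → Fin 4}
    (hiso : ∀ t, t ≤ 9 → IsIsolated 5 (c t).F) (ho : ∀ t, t ≤ 9 → ordZero (c t).F = (6 : ℕ))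
    (he3 : ∀ t, t ≤ 9 → Module.finrank K (resVertex (c t)) = 3)
    (hdiv : ∀ t, t ≤ 9 → ∀ e ∈ (c t).F.support, (c t).r ≤ e)
    (hstep : ∀ t, t < 9 → c (t + 1) = CentreBlowup.step 5 Finset.univ (j t) 0 (c t))
    (hslot : ∀ t, t < 9 → j t = la ∨ j t = mu)
    (hr : ∀ t, t ≤ 9 → (c t).r = Finsupp.single la 1 + Finsupp.single mu 1)
    (hform : ∀ t, t ≤ 9 → ∃ a : K, a ≠ 0 ∧ resForm (c t) = C a * X f ^ 4)
    (hled0 : ∀ e ∈ (c 0).F.support, e f ≤ 3 → 2 ≤ e la ∧ 2 ≤ e mu)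
    (hx0 : j 0 = la) (hx1 : j 1 = mu) : False := by
  -- bookkeeping on the window
  have hled := cInf_window_ledger hlm hlu hlf hmu hmf huf (T := 9) ho hdiv hstep hslot hr
    (fun t ht => by obtain ⟨a, -, h⟩ := hform t ht; exact ⟨a, h⟩) hled0
  have hrdeg : ∀ t, t ≤ 9 → (c t).r.degree = 2 := fun t ht => by
    rw [hr t ht, map_add, Finsupp.degree_single, Finsupp.degree_single]
  have hrf : ∀ t, t ≤ 9 → (c t).r f = 0 := fun t ht => by
    rw [hr t ht, Finsupp.add_apply, Finsupp.single_eq_of_ne hlf.symm, Finsupp.single_eq_of_ne hmf.symm, add_zero]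
  have hq : ∀ t, t ≤ 9 → ((5 : ℕ) : ℕ∞) ≤ ordAlong Finset.univ (c t).F := fun t ht => by
    rw [ordAlong_univ, ho t ht]; exact_mod_cast (by norm_num : 5 ≤ 6)
  have h6 : ∀ t, t ≤ 9 → ∀ d ∈ (c t).F.support, 6 ≤ d.degree := fun t ht => le_degree_of_ordZero_eq (ho t ht)
  have hss : ∀ t, t ≤ 9 → ∀ d ∈ (c t).F.support, d.degree = 6 → d f = 4 := fun t ht => by
    obtain ⟨a, -, hfa⟩ := hform t ht
    exact straight_support_of_resForm (ho t ht) (hdiv t ht) (hrdeg t ht) (hrf t ht) hfa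
  have hla1 : ∀ t, t ≤ 9 → ∀ d ∈ (c t).F.support, 1 ≤ d la := fun t ht d hd => by
    have h := hdiv t ht d hd la
    rw [hr t ht, Finsupp.add_apply, Finsupp.single_eq_same, Finsupp.single_eq_of_ne hlm] at h
    omega
  have hmu1 : ∀ t, t ≤ 9 → ∀ d ∈ (c t).F.support, 1 ≤ d mu := fun t ht d hd => by
    have h := hdiv t ht d hd mu
    rw [hr t ht, Finsupp.add_apply, Finsupp.single_eq_of_ne (Ne.symm hlm), Finsupp.single_eq_same] at h
    omega
  have hrswap : ∀ t, t ≤ 9 → (c t).r = Finsupp.single mu 1 + Finsupp.single la 1 := fun t ht => by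
    rw [hr t ht, add_comm]
  -- legality at a step `t ≤ 8` in the chart `κ ∈ {λ, μ}`: the F3 frame at `c t`
  have hleg : ∀ t, t < 9 → ∀ {κ o : Fin 4}, κ ≠ o → κ ≠ u → κ ≠ f → o ≠ u → o ≠ f → j t = κ →
      (c t).r = Finsupp.single κ 1 + Finsupp.single o 1 →
      (∀ d ∈ (c t).F.support, d f ≤ 3 → 2 ≤ d o) →
      ∀ {cc : ℕ}, cc ≤ 3 → ∀ {a b e : ℕ},
        coeff (Finsupp.single κ (a + 2) + Finsupp.single o (b + 2) + Finsupp.single u e +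
          Finsupp.single f (3 - cc)) (c t).F ≠ 0 → 2 * cc ≤ a + 2 * b + 2 * e := by
    intro t ht κ o hκo hκu hκf hou hof hj hrκ hledo cc hcc a b e h
    obtain ⟨af, haf, hfa⟩ := hform t (by omega)
    obtain ⟨ha, hstraight⟩ := straight_readings_of_resForm (ho t (by omega)) (hrdeg t (by omega)) hfa
    have hst := hstep t ht
    rw [hj] at hst
    have ho' : ordZero (CentreBlowup.step 5 Finset.univ κ 0 (c t)).F = (6 : ℕ) := by rw [← hst]; exact ho (t + 1) (by omega)
    have he3' : Module.finrank K (resVertex (CentreBlowup.step 5 Finset.univ κ 0 (c t))) = 3 := by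
      rw [← hst]; exact he3 (t + 1) (by omega)
    exact cInf_hleg_of_corner hκo hκu hκf hou hof huf hrκ (hdiv t (by omega)) (ho t (by omega))
      (by rw [ha]; exact haf) hstraight (tsch_row_of_ledger hκo hκf hof hrκ hledo) ho' he3' hcc h
  refine CInfGame.Window.no_play_after_change (fun t => decide (j t = la))
    (fun t m => m.1 ≤ 3 ∧ coeff (Finsupp.single la (m.2.1 + 2) + Finsupp.single mu (m.2.2.1 + 2) +
      Finsupp.single u m.2.2.2 + Finsupp.single f (3 - m.1)) (c t).F ≠ 0)
    (by simp [hx0]) (by simp [hx1, Ne.symm hlm]) (fun t cc a b e hP => hP.1) ?_ ?_ ?_ ?_ ?_ ?_ ?_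
  · -- hfwdL
    intro t cc a b e ht hP hx hnd
    dsimp only at hP ⊢
    have hj : j t = la := of_decide_eq_true hx
    have hst := hstep t (by omega)
    rw [hj] at hst
    refine ⟨hP.1, ?_⟩
    rw [hst]
    exact coeff_step_zero_gameExp_ne_zero hlm hlu hlf hmu hmf huf (c t) (hq t (by omega)) (h6 t (by omega))
      (hss t (by omega)) hP.1 hP.2 hnd
  · -- hfwdM
    intro t cc a b e ht hP hx hnd
    dsimp only at hP ⊢
    have hj : j t = mu := by
      rcases hslot t (by omega) with h | h
      · exact absurd (decide_eq_true h) (by rw [hx]; exact Bool.false_ne_true)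
      · exact h
    have hst := hstep t (by omega)
    rw [hj] at hst
    refine ⟨hP.1, ?_⟩
    have h := hP.2
    rw [gameExp_swap] at h
    have himg := coeff_step_zero_gameExp_ne_zero (Ne.symm hlm) hmu hmf hlu hlf huf (c t) (hq t (by omega))
      (h6 t (by omega)) (hss t (by omega)) hP.1 h (by omega)
    rw [hst, gameExp_swap, show a + b + e - cc = b + a + e - cc by rw [Nat.add_comm a b]]
    exact himg
  · -- hlegL
    intro t cc a b e ht hP hx
    dsimp only at hP
    have hj : j t = la := of_decide_eq_true hx
    exact hleg t (by omega) hlm hlu hlf hmu hmf hj (hr t (by omega))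
      (fun d hd hdf => (hled t (by omega) d hd hdf).2) hP.1 hP.2
  · -- hlegM
    intro t cc a b e ht hP hx
    dsimp only at hP
    have hj : j t = mu := by
      rcases hslot t (by omega) with h | h
      · exact absurd (decide_eq_true h) (by rw [hx]; exact Bool.false_ne_true)
      · exact h
    have h := hP.2
    rw [gameExp_swap] at h
    have := hleg t (by omega) (Ne.symm hlm) hmu hmf hlu hlf hj (hrswap t (by omega))
      (fun d hd hdf => (hled t (by omega) d hd hdf).1) hP.1 h
    omega
  · -- hevol
    intro t cc a b e ht hP
    dsimp only at hP ⊢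
    have ht9 : t < 9 := by omega
    have hst := hstep t ht9
    right
    rcases hslot t ht9 with hj | hj
    · rw [hj] at hst
      have h := hP.2
      rw [hst] at h
      obtain ⟨a₀, ha₀, heq⟩ := cInf_hevol_of_corner hlm hlu hlf hmu hmf huf (c t) (hla1 t (by omega))
        (fun d hd hdf => (hled t (by omega) d hd hdf).1) hP.1 h
      exact ⟨a₀, b, ⟨hP.1, ha₀⟩, Or.inl ⟨decide_eq_true hj, by omega, rfl⟩⟩
    · rw [hj] at hst
      have h := hP.2
      rw [hst, gameExp_swap] at h
      obtain ⟨b₀, hb₀, heq⟩ := cInf_hevol_of_corner (Ne.symm hlm) hmu hmf hlu hlf huf (c t) (hmu1 t (by omega))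
        (fun d hd hdf => (hled t (by omega) d hd hdf).2) hP.1 h
      rw [gameExp_swap] at hb₀
      have hx : decide (j t = la) = false := by
        rw [decide_eq_false_iff_not, hj]; exact Ne.symm hlm
      exact ⟨a, b₀, ⟨hP.1, hb₀⟩, Or.inr ⟨hx, rfl, by omega⟩⟩
  · -- hflagL
    intro t h2 h6'
    obtain ⟨cc, a, b, e, hcc, h, hb⟩ := cInf_hflag_of_isolated hlm hlu hlf hmu hmf huf (hiso t (by omega))
      (hdiv t (by omega)) (hr t (by omega)) (hled t (by omega))
    exact ⟨cc, a, b, e, ⟨hcc, h⟩, hb⟩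
  · -- hflagM
    intro t h2 h6'
    obtain ⟨cc, a, b, e, hcc, h, hb⟩ := cInf_hflag_of_isolated (Ne.symm hlm) hmu hmf hlu hlf huf (hiso t (by omega))
      (hdiv t (by omega)) (hrswap t (by omega)) (fun d hd hdf => (hled t (by omega) d hd hdf).symm)
    rw [gameExp_swap] at h
    exact ⟨cc, b, a, e, ⟨hcc, h⟩, hb⟩

end Window

end ResCone

end Summit.ResolutionOfSingularities.ResolutionOfSingularities.Theorems.PIDim4

end
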